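import Mathlib
import HarnessLib
import Summits.HubbardSuperconductivity.HubbardSuperconductivity.Theorems.ComplexGFFStiffnessHolomorphicFreeHtFamily
import Summits.HubbardSuperconductivity.HubbardSuperconductivity.Theorems.ComplexGFFStiffnessHolomorphicPackageLines
import Literature.MathematicalPhysics.StatisticalMechanics.RenormalisationMapFreeHtSmooth

/-!
# Crux child `TwoKernelSkBound` (stmt-HubbardSuperconductivity-27414), line `banach_two_kernel`, stub `stub_f4l2ShrinkLoc` —
# the three Cauchy ENGINES in the free intermediate slot (blocks B1, B2/B3), package level

Route `route-HubbardSuperconductivity-ComplexGFFStiffness`; memo `Cruxes/HypACumulant/TWOKERNEL-PLAN-27414-v3.md` §2 (R3).  With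
`G_ρ(H̃) := nextK D_ρ.s π (stepMeasure D_ρ.𝒞) (e^{−H}) (e^{−H̃}) (mulExt a)` (`D_ρ = abkmStepData P.L P.R k (Q.kernels q_ρ)`), the blocks
B1–B3 of the second-order two-kernel slot are first/second differences of `G` along complex LINES `H̃₀ + σW` (bidisc `H̃₀ + σW₁ + τW₂`) in
the intermediate slot, with the state `(H, a)` FIXED.  This file turns the generic Cauchy engines of the route
(`weakNormLE_sub_of_pointwise_holomorphic`, `weakNormLE_secondDiff_of_pointwise_holomorphic`) into package statements whose only
remaining input is a UNIFORM weak-norm bound on the disc: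

* `weakNormLE_sub_nextK_freeHt_line_package` — ONE kernel: `‖G_q(H̃₀ + σW) − G_q(H̃₀)‖_{k+1} ≤ (r₀+1)(2C/R)|σ|` given `‖G_q(H̃₀ + σ'W)‖_{k+1} ≤ C`
  on `|σ'| < R` (the excess term of B1; uniform bound = Theorem 6.8 + U1, `ComplexGFFStiffnessFreeHtLipschitz`);
* `weakNormLE_secondDiff_nextK_freeHt_package` — ONE kernel, bidisc: the parallelogram second difference along `(W₁, W₂)` is
  `≤ (r₀+1)(4C/R²)|σ||τ|` (the parallelogram part of B1);
* `weakNormLE_sub_nextK_freeHt_pair_package` — TWO kernels `q, q'` at the common `H̃₀ + σW`: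
  `‖[G_{q'} − G_q](H̃₀ + σW) − [G_{q'} − G_q](H̃₀)‖_{k+1} ≤ (r₀+1)(2C_q/R)|σ|` given the uniform pair bound `C_q` on the disc (blocks B2/B3;
  uniform bound = U2, `ComplexGFFStiffnessFreeHtKernelPair`).

Inputs discharged here: pointwise holomorphy (`differentiable_nextK_abkm_freeHt`, `…_bidisc`), per-parameter smoothness
(`contDiff_nextK_freeHt_abkm_of_stepKernelBounds`), continuity of the torus weights.  All proved, no `sorry`.  Honest scope: rung route
(stiffness of a complex Gaussian gradient field via the [ABKM19] RG); nothing about superconductivity in the Hubbard model.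

## References
* S. Adams, S. Buchholz, R. Kotecký, S. Müller, arXiv:1910.13564, Definition 6.5 (6.34), Theorem 6.8, Lemma 12.6 (12.53)
  [AdamsBuchholzKoteckyMuller2019].
-/

noncomputable section

-- `Summit.<Summit>.<Problem>`: single-conjunct summit, the duplicate component is mandated (D-0017).
set_option linter.dupNamespace false

namespace Summit.HubbardSuperconductivity.HubbardSuperconductivity.Theorems.ComplexGFF

open MeasureTheory Metric Set
open scoped BigOperators
open Literature.MathematicalPhysics.StatisticalMechanics.GradientRG
open Literature.MathematicalPhysics.StatisticalMechanics.TorusPolymer (IsPolymer blockOf reblock)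
open Literature.Barriers.CriticalPhenomena.LongRangePhi4.Polymer (IsConn)
open Literature.MathematicalPhysics.StatisticalMechanics

variable {d : ℕ}

section Engines

variable (P : PackageData d) {N M : ℕ} [NeZero M] (Q : PackageAt P N M)

set_option maxHeartbeats 800000 in
/-- **Line engine, one kernel, free intermediate slot**: for a package step kernel `𝒞_{1+q,k+1}`, a fixed state `(H, mulExt a)` with
`‖H‖_{k,0} ≤ 1/8` and admissible `a`, and ANY `H̃₀, W`: a uniform bound `C` of `σ' ↦ nextK(μ_q; e^{−H}, e^{−(H̃₀+σ'W)}, mulExt a)` in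
`‖·‖_{k+1}` on `|σ'| < R` gives `‖G(H̃₀ + σW) − G(H̃₀)‖_{k+1} ≤ (r₀+1)(2C/R)|σ|`.
[cite: AdamsBuchholzKoteckyMuller2019, Definition 6.5 (6.34) / Lemma 12.6 (12.53)] -/
theorem weakNormLE_sub_nextK_freeHt_line_package {q : Matrix (Fin d) (Fin d) ℝ} (hq : P.InBall q)
    {k : ℕ} (hk : k + 1 ≤ N) {H : RelevantHamiltonian ℂ d}
    (hH : hamNorm (fieldWt P.h (P.L : ℝ) d k) ((P.L : ℝ) ^ k) (P.L ^ (d * k)) H ≤ 1 / 8)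
    {a : Finset (Fin d → ZMod M) → ((Fin d → ZMod M) → ℝ) → ℂ} {Ca : ℝ} (hCa : 0 ≤ Ca)
    (ha : WeakNormLE Q.normParams k a Ca) (had : ∀ Y, ContDiff ℝ P.r₀ (a Y))
    (haloc : ∀ Y, IsPolymer (P.L ^ k) Y → IsConn Y → IsGaugeLocal (Q.normParams.gauge k Y) (a Y))
    (Ht₀ W : RelevantHamiltonian ℂ d) {R C : ℝ}
    (hG : ∀ σ ∈ ball (0 : ℂ) R, WeakNormLE Q.normParams (k + 1)
      (fun X ψ => nextK (abkmStepData P.L P.R k (Q.kernels q)).s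
        (reblock (abkmStepData P.L P.R k (Q.kernels q)).s
          ((abkmStepData P.L P.R k (Q.kernels q)).L * (abkmStepData P.L P.R k (Q.kernels q)).s))
        (stepMeasure (abkmStepData P.L P.R k (Q.kernels q)).𝒞) (expNegH H) (expNegH (Ht₀ + σ • W)) (mulExt a) X ψ) C)
    {σ : ℂ} (hσ : σ ∈ ball (0 : ℂ) R) :
    WeakNormLE Q.normParams (k + 1)
      (fun X ψ =>
        nextK (abkmStepData P.L P.R k (Q.kernels q)).s
            (reblock (abkmStepData P.L P.R k (Q.kernels q)).s
              ((abkmStepData P.L P.R k (Q.kernels q)).L * (abkmStepData P.L P.R k (Q.kernels q)).s))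
            (stepMeasure (abkmStepData P.L P.R k (Q.kernels q)).𝒞) (expNegH H) (expNegH (Ht₀ + σ • W)) (mulExt a) X ψ -
          nextK (abkmStepData P.L P.R k (Q.kernels q)).s
            (reblock (abkmStepData P.L P.R k (Q.kernels q)).s
              ((abkmStepData P.L P.R k (Q.kernels q)).L * (abkmStepData P.L P.R k (Q.kernels q)).s))
            (stepMeasure (abkmStepData P.L P.R k (Q.kernels q)).𝒞) (expNegH H) (expNegH (Ht₀ + (0 : ℂ) • W)) (mulExt a) X ψ)
      (((P.r₀ : ℝ) + 1) * (2 * C / R) * ‖σ‖) := by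
  set D := abkmStepData P.L P.R k (Q.kernels q) with hD
  set G : ℂ → Finset (Fin d → ZMod M) → ((Fin d → ZMod M) → ℝ) → ℂ :=
    fun σ X ψ => nextK D.s (reblock D.s (D.L * D.s)) (stepMeasure D.𝒞) (expNegH H) (expNegH (Ht₀ + σ • W)) (mulExt a) X ψ
    with hGdef
  have hS := packageAt_stepKernelBounds P Q hq hk
  have hk1 : 1 ≤ P.L ^ k := Nat.one_le_pow _ _ P.hLodd.pos
  -- engine inputs
  have hw : ∀ X, Continuous (Q.normParams.W.weight (k + 1) X) := fun X => continuous_weight _ (k + 1) X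
  have hhol : ∀ X ψ, DifferentiableOn ℂ (fun σ' => G σ' X ψ) (ball (0 : ℂ) R) := fun X ψ =>
    (differentiable_nextK_abkm_freeHt P.hd P.hLodd Q.hM hk P.hp P.hpM Q.hB P.hδ₀ P.hδ₁ P.hh P.hh0 P.hA1
      (reblock D.s (D.L * D.s)) D.𝒞 hS hH hCa ha had haloc Ht₀ W X ψ).differentiableOn
  have hKc : ∀ σ' ∈ ball (0 : ℂ) R, ∀ X, ContDiff ℝ (Q.normParams.r₀ : WithTop ℕ∞) (G σ' X) := fun σ' _ X =>
    contDiff_nextK_freeHt_abkm_of_stepKernelBounds P.hd P.hLodd P.hL Q.hM hk P.hp P.hpM P.hMR Q.hB P.hδ₀ P.hδ₁ P.hh P.hh0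
      P.hA1 D rfl rfl hS (x₀ := 0) rfl rfl hH (Ht₀ + σ' • W) hCa (weakNormLE_mulExt_iff.2 ha) (factorises_mulExt hk1) (fun φ => mulExt_empty φ)
      (fun Y => contDiff_mulExt had Y) (fun Y hY hYc => isGaugeLocal_mulExt_conn (Q.normParams.gauge k) haloc hY hYc) X
  exact weakNormLE_sub_of_pointwise_holomorphic Q.normParams (k + 1) hw (K := G) hhol hKc hG hσ

set_option maxHeartbeats 800000 in
/-- **Bidisc engine, one kernel, free intermediate slot**: the parallelogram second difference of
`(σ, τ) ↦ nextK(μ_q; e^{−H}, e^{−(H̃₀+σW₁+τW₂)}, mulExt a)` has weak norm `≤ (r₀+1)(4C/R²)|σ||τ|` given the uniform bound `C` on the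
bidisc `|σ|, |τ| < R`. [cite: AdamsBuchholzKoteckyMuller2019, Definition 6.5 (6.34) / Lemma 12.6 (12.53)] -/
theorem weakNormLE_secondDiff_nextK_freeHt_package {q : Matrix (Fin d) (Fin d) ℝ} (hq : P.InBall q)
    {k : ℕ} (hk : k + 1 ≤ N) {H : RelevantHamiltonian ℂ d}
    (hH : hamNorm (fieldWt P.h (P.L : ℝ) d k) ((P.L : ℝ) ^ k) (P.L ^ (d * k)) H ≤ 1 / 8)
    {a : Finset (Fin d → ZMod M) → ((Fin d → ZMod M) → ℝ) → ℂ} {Ca : ℝ} (hCa : 0 ≤ Ca)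
    (ha : WeakNormLE Q.normParams k a Ca) (had : ∀ Y, ContDiff ℝ P.r₀ (a Y))
    (haloc : ∀ Y, IsPolymer (P.L ^ k) Y → IsConn Y → IsGaugeLocal (Q.normParams.gauge k Y) (a Y))
    (Ht₀ W₁ W₂ : RelevantHamiltonian ℂ d) {R C : ℝ}
    (hC : ∀ σ ∈ ball (0 : ℂ) R, ∀ τ ∈ ball (0 : ℂ) R, WeakNormLE Q.normParams (k + 1)
      (fun X ψ => nextK (abkmStepData P.L P.R k (Q.kernels q)).s
        (reblock (abkmStepData P.L P.R k (Q.kernels q)).s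
          ((abkmStepData P.L P.R k (Q.kernels q)).L * (abkmStepData P.L P.R k (Q.kernels q)).s))
        (stepMeasure (abkmStepData P.L P.R k (Q.kernels q)).𝒞) (expNegH H) (expNegH (Ht₀ + σ • W₁ + τ • W₂)) (mulExt a) X ψ) C)
    {σ τ : ℂ} (hσ : σ ∈ ball (0 : ℂ) R) (hτ : τ ∈ ball (0 : ℂ) R) :
    WeakNormLE Q.normParams (k + 1)
      (fun X ψ =>
        nextK (abkmStepData P.L P.R k (Q.kernels q)).s
            (reblock (abkmStepData P.L P.R k (Q.kernels q)).s
              ((abkmStepData P.L P.R k (Q.kernels q)).L * (abkmStepData P.L P.R k (Q.kernels q)).s))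
            (stepMeasure (abkmStepData P.L P.R k (Q.kernels q)).𝒞) (expNegH H) (expNegH (Ht₀ + σ • W₁ + τ • W₂)) (mulExt a) X ψ -
        nextK (abkmStepData P.L P.R k (Q.kernels q)).s
            (reblock (abkmStepData P.L P.R k (Q.kernels q)).s
              ((abkmStepData P.L P.R k (Q.kernels q)).L * (abkmStepData P.L P.R k (Q.kernels q)).s))
            (stepMeasure (abkmStepData P.L P.R k (Q.kernels q)).𝒞) (expNegH H) (expNegH (Ht₀ + σ • W₁ + (0 : ℂ) • W₂)) (mulExt a) X ψ -
        nextK (abkmStepData P.L P.R k (Q.kernels q)).s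
            (reblock (abkmStepData P.L P.R k (Q.kernels q)).s
              ((abkmStepData P.L P.R k (Q.kernels q)).L * (abkmStepData P.L P.R k (Q.kernels q)).s))
            (stepMeasure (abkmStepData P.L P.R k (Q.kernels q)).𝒞) (expNegH H) (expNegH (Ht₀ + (0 : ℂ) • W₁ + τ • W₂)) (mulExt a) X ψ +
        nextK (abkmStepData P.L P.R k (Q.kernels q)).s
            (reblock (abkmStepData P.L P.R k (Q.kernels q)).s
              ((abkmStepData P.L P.R k (Q.kernels q)).L * (abkmStepData P.L P.R k (Q.kernels q)).s))
            (stepMeasure (abkmStepData P.L P.R k (Q.kernels q)).𝒞) (expNegH H) (expNegH (Ht₀ + (0 : ℂ) • W₁ + (0 : ℂ) • W₂)) (mulExt a) X ψ)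
      (((P.r₀ : ℝ) + 1) * (4 * C / R ^ 2) * ‖σ‖ * ‖τ‖) := by
  set D := abkmStepData P.L P.R k (Q.kernels q) with hD
  set G : ℂ → ℂ → Finset (Fin d → ZMod M) → ((Fin d → ZMod M) → ℝ) → ℂ :=
    fun σ τ X ψ => nextK D.s (reblock D.s (D.L * D.s)) (stepMeasure D.𝒞) (expNegH H) (expNegH (Ht₀ + σ • W₁ + τ • W₂)) (mulExt a) X ψ
    with hGdef
  have hS := packageAt_stepKernelBounds P Q hq hk
  have hk1 : 1 ≤ P.L ^ k := Nat.one_le_pow _ _ P.hLodd.pos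
  have hw : ∀ X, Continuous (Q.normParams.W.weight (k + 1) X) := fun X => continuous_weight _ (k + 1) X
  have hbi := fun X ψ => differentiable_nextK_abkm_freeHt_bidisc P.hd P.hLodd Q.hM hk P.hp P.hpM Q.hB P.hδ₀ P.hδ₁ P.hh P.hh0 P.hA1
      (reblock D.s (D.L * D.s)) D.𝒞 hS hH hCa ha had haloc Ht₀ W₁ W₂ X ψ
  have hholσ : ∀ τ' ∈ ball (0 : ℂ) R, ∀ X ψ, DifferentiableOn ℂ (fun σ' => G σ' τ' X ψ) (ball (0 : ℂ) R) :=
    fun τ' _ X ψ => ((hbi X ψ).1 τ').differentiableOn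
  have hholτ : ∀ σ' ∈ ball (0 : ℂ) R, ∀ X ψ, DifferentiableOn ℂ (fun τ' => G σ' τ' X ψ) (ball (0 : ℂ) R) :=
    fun σ' _ X ψ => ((hbi X ψ).2 σ').differentiableOn
  have hKc : ∀ σ' ∈ ball (0 : ℂ) R, ∀ τ' ∈ ball (0 : ℂ) R, ∀ X, ContDiff ℝ (Q.normParams.r₀ : WithTop ℕ∞) (G σ' τ' X) :=
    fun σ' _ τ' _ X =>
    contDiff_nextK_freeHt_abkm_of_stepKernelBounds P.hd P.hLodd P.hL Q.hM hk P.hp P.hpM P.hMR Q.hB P.hδ₀ P.hδ₁ P.hh P.hh0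
      P.hA1 D rfl rfl hS (x₀ := 0) rfl rfl hH (Ht₀ + σ' • W₁ + τ' • W₂) hCa (weakNormLE_mulExt_iff.2 ha) (factorises_mulExt hk1) (fun φ => mulExt_empty φ)
      (fun Y => contDiff_mulExt had Y) (fun Y hY hYc => isGaugeLocal_mulExt_conn (Q.normParams.gauge k) haloc hY hYc) X
  exact weakNormLE_secondDiff_of_pointwise_holomorphic Q.normParams (k + 1) hw (K := G) hholσ hholτ hKc hC hσ hτ

set_option maxHeartbeats 800000 in
/-- **Line engine, two kernels, common free intermediate slot** (blocks B2/B3): for package kernels `q, q'`, a fixed state and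
ANY `H̃₀, W`, a uniform bound `C_q` of the kernel-pair difference `[G_{q'} − G_q](H̃₀ + σ'W)` on `|σ'| < R` gives
`‖[G_{q'} − G_q](H̃₀ + σW) − [G_{q'} − G_q](H̃₀)‖_{k+1} ≤ (r₀+1)(2C_q/R)|σ|`.
[cite: AdamsBuchholzKoteckyMuller2019, Definition 6.5 (6.34) / Lemma 12.6 (12.53)] -/
theorem weakNormLE_sub_nextK_freeHt_pair_package {q q' : Matrix (Fin d) (Fin d) ℝ} (hq : P.InBall q) (hq' : P.InBall q')
    {k : ℕ} (hk : k + 1 ≤ N) {H : RelevantHamiltonian ℂ d}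
    (hH : hamNorm (fieldWt P.h (P.L : ℝ) d k) ((P.L : ℝ) ^ k) (P.L ^ (d * k)) H ≤ 1 / 8)
    {a : Finset (Fin d → ZMod M) → ((Fin d → ZMod M) → ℝ) → ℂ} {Ca : ℝ} (hCa : 0 ≤ Ca)
    (ha : WeakNormLE Q.normParams k a Ca) (had : ∀ Y, ContDiff ℝ P.r₀ (a Y))
    (haloc : ∀ Y, IsPolymer (P.L ^ k) Y → IsConn Y → IsGaugeLocal (Q.normParams.gauge k Y) (a Y))
    (Ht₀ W : RelevantHamiltonian ℂ d) {R Cq : ℝ}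
    (hG : ∀ σ ∈ ball (0 : ℂ) R, WeakNormLE Q.normParams (k + 1)
      (fun X ψ => nextK (abkmStepData P.L P.R k (Q.kernels q')).s
          (reblock (abkmStepData P.L P.R k (Q.kernels q')).s
            ((abkmStepData P.L P.R k (Q.kernels q')).L * (abkmStepData P.L P.R k (Q.kernels q')).s))
          (stepMeasure (abkmStepData P.L P.R k (Q.kernels q')).𝒞) (expNegH H) (expNegH (Ht₀ + σ • W)) (mulExt a) X ψ -
        nextK (abkmStepData P.L P.R k (Q.kernels q)).s
          (reblock (abkmStepData P.L P.R k (Q.kernels q)).s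
            ((abkmStepData P.L P.R k (Q.kernels q)).L * (abkmStepData P.L P.R k (Q.kernels q)).s))
          (stepMeasure (abkmStepData P.L P.R k (Q.kernels q)).𝒞) (expNegH H) (expNegH (Ht₀ + σ • W)) (mulExt a) X ψ) Cq)
    {σ : ℂ} (hσ : σ ∈ ball (0 : ℂ) R) :
    WeakNormLE Q.normParams (k + 1)
      (fun X ψ =>
        (nextK (abkmStepData P.L P.R k (Q.kernels q')).s
            (reblock (abkmStepData P.L P.R k (Q.kernels q')).s
              ((abkmStepData P.L P.R k (Q.kernels q')).L * (abkmStepData P.L P.R k (Q.kernels q')).s))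
            (stepMeasure (abkmStepData P.L P.R k (Q.kernels q')).𝒞) (expNegH H) (expNegH (Ht₀ + σ • W)) (mulExt a) X ψ -
          nextK (abkmStepData P.L P.R k (Q.kernels q)).s
            (reblock (abkmStepData P.L P.R k (Q.kernels q)).s
              ((abkmStepData P.L P.R k (Q.kernels q)).L * (abkmStepData P.L P.R k (Q.kernels q)).s))
            (stepMeasure (abkmStepData P.L P.R k (Q.kernels q)).𝒞) (expNegH H) (expNegH (Ht₀ + σ • W)) (mulExt a) X ψ) -
        (nextK (abkmStepData P.L P.R k (Q.kernels q')).s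
            (reblock (abkmStepData P.L P.R k (Q.kernels q')).s
              ((abkmStepData P.L P.R k (Q.kernels q')).L * (abkmStepData P.L P.R k (Q.kernels q')).s))
            (stepMeasure (abkmStepData P.L P.R k (Q.kernels q')).𝒞) (expNegH H) (expNegH (Ht₀ + (0 : ℂ) • W)) (mulExt a) X ψ -
          nextK (abkmStepData P.L P.R k (Q.kernels q)).s
            (reblock (abkmStepData P.L P.R k (Q.kernels q)).s
              ((abkmStepData P.L P.R k (Q.kernels q)).L * (abkmStepData P.L P.R k (Q.kernels q)).s))
            (stepMeasure (abkmStepData P.L P.R k (Q.kernels q)).𝒞) (expNegH H) (expNegH (Ht₀ + (0 : ℂ) • W)) (mulExt a) X ψ))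
      (((P.r₀ : ℝ) + 1) * (2 * Cq / R) * ‖σ‖) := by
  set D := abkmStepData P.L P.R k (Q.kernels q) with hD
  set D' := abkmStepData P.L P.R k (Q.kernels q') with hD'
  set G : ℂ → Finset (Fin d → ZMod M) → ((Fin d → ZMod M) → ℝ) → ℂ :=
    fun σ X ψ => nextK D'.s (reblock D'.s (D'.L * D'.s)) (stepMeasure D'.𝒞) (expNegH H) (expNegH (Ht₀ + σ • W)) (mulExt a) X ψ -
      nextK D.s (reblock D.s (D.L * D.s)) (stepMeasure D.𝒞) (expNegH H) (expNegH (Ht₀ + σ • W)) (mulExt a) X ψ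
    with hGdef
  have hS := packageAt_stepKernelBounds P Q hq hk
  have hS' := packageAt_stepKernelBounds P Q hq' hk
  have hk1 : 1 ≤ P.L ^ k := Nat.one_le_pow _ _ P.hLodd.pos
  have hw : ∀ X, Continuous (Q.normParams.W.weight (k + 1) X) := fun X => continuous_weight _ (k + 1) X
  have hhol : ∀ X ψ, DifferentiableOn ℂ (fun σ' => G σ' X ψ) (ball (0 : ℂ) R) := by
    intro X ψ
    have h1 := differentiable_nextK_abkm_freeHt P.hd P.hLodd Q.hM hk P.hp P.hpM Q.hB P.hδ₀ P.hδ₁ P.hh P.hh0 P.hA1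
      (reblock D'.s (D'.L * D'.s)) D'.𝒞 hS' hH hCa ha had haloc Ht₀ W X ψ
    have h2 := differentiable_nextK_abkm_freeHt P.hd P.hLodd Q.hM hk P.hp P.hpM Q.hB P.hδ₀ P.hδ₁ P.hh P.hh0 P.hA1
      (reblock D.s (D.L * D.s)) D.𝒞 hS hH hCa ha had haloc Ht₀ W X ψ
    exact (h1.sub h2).differentiableOn
  have hKc : ∀ σ' ∈ ball (0 : ℂ) R, ∀ X, ContDiff ℝ (Q.normParams.r₀ : WithTop ℕ∞) (G σ' X) := by
    intro σ' _ X
    have h1 := contDiff_nextK_freeHt_abkm_of_stepKernelBounds P.hd P.hLodd P.hL Q.hM hk P.hp P.hpM P.hMR Q.hB P.hδ₀ P.hδ₁ P.hh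
      P.hh0 P.hA1 D' rfl rfl hS' (x₀ := 0) rfl rfl hH (Ht₀ + σ' • W) hCa (weakNormLE_mulExt_iff.2 ha) (factorises_mulExt hk1) (fun φ => mulExt_empty φ)
      (fun Y => contDiff_mulExt had Y) (fun Y hY hYc => isGaugeLocal_mulExt_conn (Q.normParams.gauge k) haloc hY hYc) X
    have h2 := contDiff_nextK_freeHt_abkm_of_stepKernelBounds P.hd P.hLodd P.hL Q.hM hk P.hp P.hpM P.hMR Q.hB P.hδ₀ P.hδ₁ P.hh
      P.hh0 P.hA1 D rfl rfl hS (x₀ := 0) rfl rfl hH (Ht₀ + σ' • W) hCa (weakNormLE_mulExt_iff.2 ha) (factorises_mulExt hk1) (fun φ => mulExt_empty φ)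
      (fun Y => contDiff_mulExt had Y) (fun Y hY hYc => isGaugeLocal_mulExt_conn (Q.normParams.gauge k) haloc hY hYc) X
    exact h1.sub h2
  exact weakNormLE_sub_of_pointwise_holomorphic Q.normParams (k + 1) hw (K := G) hhol hKc hG hσ

end Engines

end Summit.HubbardSuperconductivity.HubbardSuperconductivity.Theorems.ComplexGFF

end
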